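import Summits.CriticalPhenomena.SAWScalingLimit.Theses.SAWTowerCount
import Literature.Probability.RandomPlanarGeometry.SAWScalingLimitFamily

/-!
# Line `birth` — registered skeleton for the crux `TameOfLimit` (stmt-CriticalPhenomena-7256)

Crux (FIXED; rank 5 of `route-CriticalPhenomena-SAWTowerCount`, decl
`Summit.CriticalPhenomena.SAWScalingLimit.Theses.SAWTowerCount.TameOfLimit`): every chordal family `P`
that is the FULL scaling limit `(lim)` of the critical `δℤ²` SAW laws (every Dobrushin domain, every
endpoint approximation) is TAME: for every `D`, `P D`-a.s.

  (BA) `γ.range ∩ ∂D ⊆ {a, b}`  (boundary avoidance except at the marked points), and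
  (NR) `range γ ≃ₜ [0,1] → γ ∈ CurveClass.simple`  (no retracing of an arc).

The hypothesis `P.IsChordal ∧ (lim)` is literally `SAW.IsScalingLimitFamily P`
(`Literature/…/SAWScalingLimitFamily.lean`, `isScalingLimitFamily_iff` is `Iff.rfl`).

## The cut: two LATTICE ESTIMATES per clause, separated from their SOFT PASSAGES to the limit

The crux's own informal text names two lattice mechanisms — "boundary avoidance from mass covariance
near boundary bumps" and "an ε-retrace forces THREE STRANDS of one walk through an o(1)-tube of length
ε, whose x_c-cost is governed by the 3-strand/1-strand corridor gap". The skeleton isolates exactly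
these as uniform-in-the-mesh probability bounds on OPEN polyline events (strict inequalities only,
universal clauses over compact parameter intervals — the event technology of
`Theorems/SAWLoopFugacityFlowSimpleSubseqLimitsStubPassage.lean` and
`Theorems/SAWRenewalTightnessSubseqIdentificationSawNoReturn.lean`), stated along the eventual mesh
filter `𝓝[>] 0` (NOT for all `δ ∈ (0,1]`: negatives index stmt-CriticalPhenomena-0772), and puts the
whole topological / measure-theoretic content into two passage stubs that are provable now:

* S1 `stub_boundaryProximityBound` (lattice, L–XL, open) — NO BOUNDARY CRAWLING: for every Dobrushin
  domain, endpoint approximation, `ρ > 0` and `ε > 0` there is `η > 0` such that, for all small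
  meshes, the critical SAW polyline comes `η`-close to a boundary point of `D` lying at distance
  `≥ ρ` from both marked points only with probability `≤ ε`.
* S2 `stub_endpointReturnBound` (lattice, L, open) — NO RETURN TO A MARKED POINT: with probability
  `≤ ε` for small meshes, the polyline does not come back `η`-close to its starting point after
  having been `r`-far from it, nor is it `η`-close to its endpoint before an `r`-far excursion
  (two further legs at a boundary point; cf. `NoReturnAlong` of the SubseqIdentification line, there
  derived from describability — here it is a lattice estimate under `(lim)` only).
* S3 `stub_tripleStrandBound` (lattice, XL, open; the LOAD-BEARING stub) — NO THREE STRANDS IN ONE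
  TUBE: with probability `≤ ε` for small meshes, the polyline does not contain three disjoint
  sub-walks, each of diameter `> r`, pairwise at Hausdorff distance `< η` (the crux's "three strands
  of one walk through an o(1)-tube", tube = `η`-neighbourhood of any one strand, possibly fractal;
  intended mechanism: 3-strand versus 1-strand corridor gap / reconnection surgery).
* S4 `stub_boundaryAvoidance_of_bound` (passage, M, provable now) — S1 along ONE endpoint
  approximation of `D` + `SAW.IsScalingLimitFamily P` ⇒ (BA) for `P D`: the thickened events
  `{∃ z ∈ range, ∃ w ∈ ∂D ∖ (B(a,ρ) ∪ B(b,ρ)), |z − w| < η}` are OPEN in `CurveClass ℂ` (ranges move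
  by at most the reparametrisation distance, `Curve.infDist_range_le`), so portmanteau
  (`ProbabilityMeasure.le_liminf_measure_open_of_tendsto`; lattice laws eventually probability
  measures, `eventually_isProbabilityMeasure_law`) gives `P D (event) ≤ ε`; `η ↓ 0`, `ε ↓ 0`, then a
  countable union over rational `ρ`.
* S5 `stub_noRetrace_of_bounds` (passage, L, provable now) — S3 and S2 along ONE endpoint
  approximation of `D` + `SAW.IsScalingLimitFamily P` ⇒ (NR) for `P D`. Deterministic core: if
  `range γ` is an arc with chart `h : range γ ≃ₜ [0,1]` and `u := h ∘ γ`, then (T2) `u` monotone or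
  antitone ⇒ `CurveClass.mk γ ∈ CurveClass.simple` (approximate `u` uniformly by the homeomorphisms
  `(1 − 1/n)u + id/n`; uniform continuity of `h⁻¹`; `mk_eq_mk_iff_dist_eq_zero`), and (T1) `u` neither
  ⇒ EITHER `u(0) ∉ {0,1}` or `u(1) ∉ {0,1}` (IVT: the curve revisits its source after, resp. previsits
  its target before, a macroscopic excursion — the EXACT version of S2's event, for every `η > 0`) OR
  some band `[x′,y′]` is crossed three times by `u` (up–down–up), i.e. three pairwise disjoint
  parameter intervals with the SAME image `h⁻¹[x′,y′]` of positive diameter — the exact version of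
  S3's event for every `η > 0`. Both thickened events are open (strict inequalities; the `∀ p ∃ q`
  closeness clause has uniform slack by compactness); portmanteau + the bounds make
  `⋂ₙ (TripleStrand r n⁻¹ ∪ EndpointReturn r n⁻¹)` a `P D`-null set for each rational `r > 0`, and
  `{arc ∧ ¬ simple}` lies in their union over `r`.

`TameOfLimit_of` (kernel-checked, no `sorry` of its own) picks an endpoint approximation of `D`
(`SAW.exists_isEndpointApprox`, proved in the tree), feeds S1 to S4 and S3, S2 to S5, and joins the
two a.e. statements (`Filter.Eventually.and`); hypotheses = the five stubs under their registered
names (`__Registered.stub_…`), conclusion = the route decl BY NAME.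

Every stub is implied by the conjunct `SAWScalingLimit` together with standard SLE_{8/3} facts
(a.s. simple, boundary-avoiding, no return to the marked points) through the CLOSED-set half of
portmanteau, so none is stronger than the summit; S4, S5 are unconditional. No `Disproof.lean` /
Negative lemma exists for this crux (`ledger crux ls stmt-CriticalPhenomena-7256`: no workfiles,
2026-08-17). Negatives index (11 entries) checked: only stmt-0772 (all-`δ` tightness) is nearby and is
avoided by the eventual filter.
-/

noncomputable section

open MeasureTheory Filter Topology Set Metric
open Literature.Probability.RandomPlanarGeometry Literature.Probability.LatticeModels

namespace Summit.CriticalPhenomena.SAWScalingLimit.Cruxes.TameOfLimit.Birth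

/-! ### Vocabulary of the line: three polyline events (documentation; the stubs inline them) -/

/-- **Near the boundary away from the marks.** The trace of `c` comes `η`-close to a boundary point
`w ∈ ∂D` at distance `≥ ρ` from both marked points `a = D.pt 0`, `b = D.pt 1`. Empty-safe (no
`infDist` junk when no such `w` exists). -/
def NearBoundary (D : DobrushinDomain) (ρ η : ℝ) : Set (CurveClass ℂ) :=
  {c | ∃ z ∈ c.range, ∃ w ∈ frontier D.carrier,
    ρ ≤ dist w (D.pt 0) ∧ ρ ≤ dist w (D.pt 1) ∧ dist z w < η}

/-- **Return to the source / previsit of the target** (thickened, open): some representative is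
`r`-far from its starting point at a time `t₁` and `η`-close to it at a later time `t₂`, or
`η`-close to its endpoint at `t₁` and `r`-far from it at a later `t₂`. -/
def EndpointReturn (r η : ℝ) : Set (CurveClass ℂ) :=
  CurveClass.mk '' {γ : Curve ℂ | ∃ t₁ t₂ : unitInterval, t₁ < t₂ ∧
    ((r < dist (γ t₁) (γ 0) ∧ dist (γ t₂) (γ 0) < η) ∨
      (dist (γ t₁) (γ 1) < η ∧ r < dist (γ t₂) (γ 1)))}

/-- **Three strands in one tube** (thickened, open): some representative has three pairwise
disjoint, time-ordered parameter intervals `[s k, t k]`, each image containing two points at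
distance `> r`, and the three images pairwise `η`-close in the Hausdorff sense
(`∀ p ∈ [s j, t j], ∃ q ∈ [s k, t k], |γ p − γ q| < η`). -/
def TripleStrand (r η : ℝ) : Set (CurveClass ℂ) :=
  CurveClass.mk '' {γ : Curve ℂ | ∃ s t : Fin 3 → unitInterval,
    (∀ k, s k ≤ t k) ∧ t 0 < s 1 ∧ t 1 < s 2 ∧
    (∀ k, ∃ p ∈ Set.Icc (s k) (t k), ∃ q ∈ Set.Icc (s k) (t k), r < dist (γ p) (γ q)) ∧
    (∀ j k, ∀ p ∈ Set.Icc (s j) (t j), ∃ q ∈ Set.Icc (s k) (t k), dist (γ p) (γ q) < η)}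

/-! ### The five statements, named (each body is VERBATIM the registered stub signature below) -/

/-- **S1, named.** Uniform no-boundary-crawling bound for the critical `δℤ²` SAW. -/
def BoundaryProximityBound : Prop :=
  ∀ (D : DobrushinDomain) (a b : ℝ → Site 2), SAW.IsEndpointApprox D a b →
    ∀ ρ ε : ℝ, 0 < ρ → 0 < ε → ∃ η : ℝ, 0 < η ∧ ∀ᶠ δ in 𝓝[>] (0 : ℝ),
      SAW.law D.carrier δ (a δ) (b δ)
          {γ | ∃ z ∈ γ.curve.range, ∃ w ∈ frontier D.carrier,
            ρ ≤ dist w (D.pt 0) ∧ ρ ≤ dist w (D.pt 1) ∧ dist z w < η} ≤ ENNReal.ofReal ε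

/-- **S2, named.** Uniform no-return-to-a-marked-point bound for the critical `δℤ²` SAW. -/
def EndpointReturnBound : Prop :=
  ∀ (D : DobrushinDomain) (a b : ℝ → Site 2), SAW.IsEndpointApprox D a b →
    ∀ r ε : ℝ, 0 < r → 0 < ε → ∃ η : ℝ, 0 < η ∧ ∀ᶠ δ in 𝓝[>] (0 : ℝ),
      SAW.law D.carrier δ (a δ) (b δ)
          {γ | γ.curve ∈ CurveClass.mk '' {c : Curve ℂ | ∃ t₁ t₂ : unitInterval, t₁ < t₂ ∧
            ((r < dist (c t₁) (c 0) ∧ dist (c t₂) (c 0) < η) ∨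
              (dist (c t₁) (c 1) < η ∧ r < dist (c t₂) (c 1)))}} ≤ ENNReal.ofReal ε

/-- **S3, named.** Uniform no-three-strands-in-one-tube bound for the critical `δℤ²` SAW. -/
def TripleStrandBound : Prop :=
  ∀ (D : DobrushinDomain) (a b : ℝ → Site 2), SAW.IsEndpointApprox D a b →
    ∀ r ε : ℝ, 0 < r → 0 < ε → ∃ η : ℝ, 0 < η ∧ ∀ᶠ δ in 𝓝[>] (0 : ℝ),
      SAW.law D.carrier δ (a δ) (b δ)
          {γ | γ.curve ∈ CurveClass.mk '' {c : Curve ℂ | ∃ s t : Fin 3 → unitInterval,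
            (∀ k, s k ≤ t k) ∧ t 0 < s 1 ∧ t 1 < s 2 ∧
            (∀ k, ∃ p ∈ Set.Icc (s k) (t k), ∃ q ∈ Set.Icc (s k) (t k),
              r < dist (c p) (c q)) ∧
            (∀ j k, ∀ p ∈ Set.Icc (s j) (t j), ∃ q ∈ Set.Icc (s k) (t k),
              dist (c p) (c q) < η)}} ≤ ENNReal.ofReal ε

/-- **S4, named.** Passage: the boundary bound along ONE endpoint approximation of `D` gives
boundary avoidance of `P D` for every full scaling-limit family `P`. -/
def BoundaryAvoidancePassage : Prop :=
  ∀ P : ChordalFamily, SAW.IsScalingLimitFamily P → ∀ D : DobrushinDomain,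
    (∃ a b : ℝ → Site 2, SAW.IsEndpointApprox D a b ∧
      ∀ ρ ε : ℝ, 0 < ρ → 0 < ε → ∃ η : ℝ, 0 < η ∧ ∀ᶠ δ in 𝓝[>] (0 : ℝ),
        SAW.law D.carrier δ (a δ) (b δ)
            {γ | ∃ z ∈ γ.curve.range, ∃ w ∈ frontier D.carrier,
              ρ ≤ dist w (D.pt 0) ∧ ρ ≤ dist w (D.pt 1) ∧ dist z w < η} ≤ ENNReal.ofReal ε) →
    ∀ᵐ γ ∂(P D), γ.range ∩ frontier D.carrier ⊆ {D.pt 0, D.pt 1}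

/-- **S5, named.** Passage: the triple-strand and endpoint-return bounds along ONE endpoint
approximation of `D` give no-retrace of `P D` for every full scaling-limit family `P`. -/
def NoRetracePassage : Prop :=
  ∀ P : ChordalFamily, SAW.IsScalingLimitFamily P → ∀ D : DobrushinDomain,
    (∃ a b : ℝ → Site 2, SAW.IsEndpointApprox D a b ∧
      (∀ r ε : ℝ, 0 < r → 0 < ε → ∃ η : ℝ, 0 < η ∧ ∀ᶠ δ in 𝓝[>] (0 : ℝ),
        SAW.law D.carrier δ (a δ) (b δ)
            {γ | γ.curve ∈ CurveClass.mk '' {c : Curve ℂ | ∃ s t : Fin 3 → unitInterval,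
              (∀ k, s k ≤ t k) ∧ t 0 < s 1 ∧ t 1 < s 2 ∧
              (∀ k, ∃ p ∈ Set.Icc (s k) (t k), ∃ q ∈ Set.Icc (s k) (t k),
                r < dist (c p) (c q)) ∧
              (∀ j k, ∀ p ∈ Set.Icc (s j) (t j), ∃ q ∈ Set.Icc (s k) (t k),
                dist (c p) (c q) < η)}} ≤ ENNReal.ofReal ε) ∧
      (∀ r ε : ℝ, 0 < r → 0 < ε → ∃ η : ℝ, 0 < η ∧ ∀ᶠ δ in 𝓝[>] (0 : ℝ),
        SAW.law D.carrier δ (a δ) (b δ)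
            {γ | γ.curve ∈ CurveClass.mk '' {c : Curve ℂ | ∃ t₁ t₂ : unitInterval, t₁ < t₂ ∧
              ((r < dist (c t₁) (c 0) ∧ dist (c t₂) (c 0) < η) ∨
                (dist (c t₁) (c 1) < η ∧ r < dist (c t₂) (c 1)))}} ≤ ENNReal.ofReal ε)) →
    ∀ᵐ γ ∂(P D), Nonempty (Set.Icc (0 : ℝ) 1 ≃ₜ γ.range) → γ ∈ CurveClass.simple

/-! ### Consistency of the vocabulary with the inlined statements (definitional) -/

example : BoundaryProximityBound ↔
    ∀ (D : DobrushinDomain) (a b : ℝ → Site 2), SAW.IsEndpointApprox D a b →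
      ∀ ρ ε : ℝ, 0 < ρ → 0 < ε → ∃ η : ℝ, 0 < η ∧ ∀ᶠ δ in 𝓝[>] (0 : ℝ),
        SAW.law D.carrier δ (a δ) (b δ) {γ | γ.curve ∈ NearBoundary D ρ η} ≤ ENNReal.ofReal ε :=
  Iff.rfl

example : EndpointReturnBound ↔
    ∀ (D : DobrushinDomain) (a b : ℝ → Site 2), SAW.IsEndpointApprox D a b →
      ∀ r ε : ℝ, 0 < r → 0 < ε → ∃ η : ℝ, 0 < η ∧ ∀ᶠ δ in 𝓝[>] (0 : ℝ),
        SAW.law D.carrier δ (a δ) (b δ) {γ | γ.curve ∈ EndpointReturn r η} ≤ ENNReal.ofReal ε :=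
  Iff.rfl

example : TripleStrandBound ↔
    ∀ (D : DobrushinDomain) (a b : ℝ → Site 2), SAW.IsEndpointApprox D a b →
      ∀ r ε : ℝ, 0 < r → 0 < ε → ∃ η : ℝ, 0 < η ∧ ∀ᶠ δ in 𝓝[>] (0 : ℝ),
        SAW.law D.carrier δ (a δ) (b δ) {γ | γ.curve ∈ TripleStrand r η} ≤ ENNReal.ofReal ε :=
  Iff.rfl

/-! ### The stubs (the ONLY `sorry`s of this file)

Each stub is stated over TREE VOCABULARY ONLY (the named statements above, verbatim), so that it
lands as a `Theorems/SAWTowerCountTameOfLimit<Stub>.lean` file `--supports stmt-CriticalPhenomena-7256`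
without importing this workfile; to elaborate the registered signature text verbatim a prover needs
`open MeasureTheory Filter Topology Literature.Probability.RandomPlanarGeometry
Literature.Probability.LatticeModels`. -/

/-- **S1 — no boundary crawling (lattice estimate, uniform in the mesh).** For the critical
`x_c`-weighted SAW of `(Ω_δ; a_δ, b_δ)`: the polyline comes `η`-close to `∂Ω` at distance `≥ ρ`
from both marked points with probability `≤ ε` for all small `δ`, once `η = η(D, a, b, ρ, ε)` is
small. Heuristic: boundary proximity of a restriction-5/8 / SLE_{8/3} curve costs `η²` per boundary
point, `O(η)` after summing (LSW 2003 one-sided restriction; mass covariance near boundary bumps,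
Kennedy–Lawler 2013); no rigorous SAW estimate at `x_c` is in print. Implied by the conjunct (closed
half of portmanteau + boundary avoidance of SLE_{8/3}). -/
theorem stub_boundaryProximityBound :
    ∀ (D : DobrushinDomain) (a b : ℝ → Site 2), SAW.IsEndpointApprox D a b →
      ∀ ρ ε : ℝ, 0 < ρ → 0 < ε → ∃ η : ℝ, 0 < η ∧ ∀ᶠ δ in 𝓝[>] (0 : ℝ),
        SAW.law D.carrier δ (a δ) (b δ)
            {γ | ∃ z ∈ γ.curve.range, ∃ w ∈ frontier D.carrier,
              ρ ≤ dist w (D.pt 0) ∧ ρ ≤ dist w (D.pt 1) ∧ dist z w < η} ≤ ENNReal.ofReal ε := by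
  sorry

/-- **S2 — no return to a marked point (lattice estimate, uniform in the mesh).** With probability
`≤ ε` for small `δ`: the polyline is not `η`-close to its starting point `δ·a_δ` after having been
`r`-far from it, and not `η`-close to its endpoint `δ·b_δ` before being `r`-far from it (the second
clause is the first for the reversed walk, `(Ω_δ; b_δ, a_δ)`, LSW 2004 §3.1). Two extra legs at a
boundary point: boundary 3-leg versus 1-leg exponent. Implied by the conjunct (SLE_{8/3} a.s. never
revisits `a` nor previsits `b`). -/
theorem stub_endpointReturnBound :
    ∀ (D : DobrushinDomain) (a b : ℝ → Site 2), SAW.IsEndpointApprox D a b →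
      ∀ r ε : ℝ, 0 < r → 0 < ε → ∃ η : ℝ, 0 < η ∧ ∀ᶠ δ in 𝓝[>] (0 : ℝ),
        SAW.law D.carrier δ (a δ) (b δ)
            {γ | γ.curve ∈ CurveClass.mk '' {c : Curve ℂ | ∃ t₁ t₂ : unitInterval, t₁ < t₂ ∧
              ((r < dist (c t₁) (c 0) ∧ dist (c t₂) (c 0) < η) ∨
                (dist (c t₁) (c 1) < η ∧ r < dist (c t₂) (c 1)))}} ≤ ENNReal.ofReal ε := by
  sorry

/-- **S3 (load-bearing) — no three strands in one tube (lattice estimate, uniform in the mesh).**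
With probability `≤ ε` for small `δ`, the critical SAW polyline has no three pairwise disjoint,
time-ordered sub-curves, each of diameter `> r`, pairwise at Hausdorff distance `< η`. This is the
crux's "ε-retrace forces three strands of one walk through an o(1)-tube": the tube is the
`η`-neighbourhood of one strand and may follow a fractal arc, so the intended proof needs a
scale-uniform 3-strand-versus-1-strand penalty (corridor gap `h₃ − h₁ > 0` box by box, or a
reconnection surgery à la Kesten / Hammersley–Welsh / Duminil-Copin–Hammond that short-circuits the
there–back–there and gains `μ^{2ℓ/δ}`); no such estimate is in print. Implied by the conjunct
(SLE_{8/3} is a.s. simple; compactness of the witness parameters). -/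
theorem stub_tripleStrandBound :
    ∀ (D : DobrushinDomain) (a b : ℝ → Site 2), SAW.IsEndpointApprox D a b →
      ∀ r ε : ℝ, 0 < r → 0 < ε → ∃ η : ℝ, 0 < η ∧ ∀ᶠ δ in 𝓝[>] (0 : ℝ),
        SAW.law D.carrier δ (a δ) (b δ)
            {γ | γ.curve ∈ CurveClass.mk '' {c : Curve ℂ | ∃ s t : Fin 3 → unitInterval,
              (∀ k, s k ≤ t k) ∧ t 0 < s 1 ∧ t 1 < s 2 ∧
              (∀ k, ∃ p ∈ Set.Icc (s k) (t k), ∃ q ∈ Set.Icc (s k) (t k),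
                r < dist (c p) (c q)) ∧
              (∀ j k, ∀ p ∈ Set.Icc (s j) (t j), ∃ q ∈ Set.Icc (s k) (t k),
                dist (c p) (c q) < η)}} ≤ ENNReal.ofReal ε := by
  sorry

/-- **S4 — passage to boundary avoidance (soft, provable now).** For a full scaling-limit family
`P` and a Dobrushin domain `D` carrying ONE endpoint approximation along which the S1-bound holds,
`P D`-a.e. trace meets `∂D` only at the marked points. Proof: the thickened event
`U(ρ,η) = {∃ z ∈ range, ∃ w ∈ ∂D, ρ ≤ |w−a|, ρ ≤ |w−b|, |z−w| < η}` is open in `CurveClass ℂ`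
(`Curve.infDist_range_le`); the lattice laws are eventually probability measures
(`eventually_isProbabilityMeasure_law`) and converge weakly to `P D` (`TendstoLaw`, `integral_map`),
so `P D (U(ρ,η)) ≤ liminf_δ P_δ(U(ρ,η)) ≤ ε` (`ProbabilityMeasure.le_liminf_measure_open_of_tendsto`
along a sequence `δ_n → 0⁺`); hence `P D {range meets ∂D ∖ (B(a,ρ) ∪ B(b,ρ))} = 0` for every `ρ > 0`,
and a countable union over `ρ = 1/(n+1)` finishes. -/
theorem stub_boundaryAvoidance_of_bound :
    ∀ P : ChordalFamily, SAW.IsScalingLimitFamily P → ∀ D : DobrushinDomain,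
      (∃ a b : ℝ → Site 2, SAW.IsEndpointApprox D a b ∧
        ∀ ρ ε : ℝ, 0 < ρ → 0 < ε → ∃ η : ℝ, 0 < η ∧ ∀ᶠ δ in 𝓝[>] (0 : ℝ),
          SAW.law D.carrier δ (a δ) (b δ)
              {γ | ∃ z ∈ γ.curve.range, ∃ w ∈ frontier D.carrier,
                ρ ≤ dist w (D.pt 0) ∧ ρ ≤ dist w (D.pt 1) ∧ dist z w < η} ≤ ENNReal.ofReal ε) →
      ∀ᵐ γ ∂(P D), γ.range ∩ frontier D.carrier ⊆ {D.pt 0, D.pt 1} := by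
  sorry

/-- **S5 — passage to no-retrace (soft, provable now).** For a full scaling-limit family `P` and a
Dobrushin domain `D` carrying ONE endpoint approximation along which the S3- and S2-bounds hold,
`P D`-a.e. class whose trace is an arc is simple. Deterministic core, for a representative `γ` with
chart `h : range γ ≃ₜ [0,1]`, `u = h ∘ γ`: (T2) `u` monotone or antitone ⇒ `mk γ ∈ CurveClass.simple`
(the homeomorphisms `(1 − 1/n)·u + id/n → u` uniformly, uniform continuity of `h⁻¹`,
`CurveClass.mk_eq_mk_iff_dist_eq_zero`, `CurveClass.mk_mem_simple`); (T1) otherwise either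
`u 0 ∉ {0,1}` / `u 1 ∉ {0,1}` (IVT ⇒ an EXACT return to `γ 0` after, resp. previsit of `γ 1`
before, an excursion to `h⁻¹ 0` or `h⁻¹ 1` — inside `EndpointReturn r η` for all `η > 0` and
`r < |h⁻¹ i − γ 0|`), or `u 0 = 0, u 1 = 1` (up to reversal) and `u t₁ > u t₂` for some `t₁ < t₂`,
whence three crossings of a band `[x′,y′] ⊆ (u t₂, u t₁)`: three pairwise disjoint, ordered
intervals with the same image `h⁻¹[x′,y′]` — inside `TripleStrand r η` for all `η > 0` and small
rational `r`. Both events are open (strict inequalities; uniform slack of the `∀ p ∃ q` clause by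
compactness, `Curve.exists_dist_reparam_lt` transports witnesses; `SeparationQuotient.mk` is open),
so portmanteau and the bounds make `⋂ₙ (TripleStrand r n⁻¹ ∪ EndpointReturn r n⁻¹)` `P D`-null for
every rational `r > 0` (monotone in `η`), and `{arc ∧ ¬simple}` lies in the union over `r`. -/
theorem stub_noRetrace_of_bounds :
    ∀ P : ChordalFamily, SAW.IsScalingLimitFamily P → ∀ D : DobrushinDomain,
      (∃ a b : ℝ → Site 2, SAW.IsEndpointApprox D a b ∧
        (∀ r ε : ℝ, 0 < r → 0 < ε → ∃ η : ℝ, 0 < η ∧ ∀ᶠ δ in 𝓝[>] (0 : ℝ),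
          SAW.law D.carrier δ (a δ) (b δ)
              {γ | γ.curve ∈ CurveClass.mk '' {c : Curve ℂ | ∃ s t : Fin 3 → unitInterval,
                (∀ k, s k ≤ t k) ∧ t 0 < s 1 ∧ t 1 < s 2 ∧
                (∀ k, ∃ p ∈ Set.Icc (s k) (t k), ∃ q ∈ Set.Icc (s k) (t k),
                  r < dist (c p) (c q)) ∧
                (∀ j k, ∀ p ∈ Set.Icc (s j) (t j), ∃ q ∈ Set.Icc (s k) (t k),
                  dist (c p) (c q) < η)}} ≤ ENNReal.ofReal ε) ∧
        (∀ r ε : ℝ, 0 < r → 0 < ε → ∃ η : ℝ, 0 < η ∧ ∀ᶠ δ in 𝓝[>] (0 : ℝ),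
          SAW.law D.carrier δ (a δ) (b δ)
              {γ | γ.curve ∈ CurveClass.mk '' {c : Curve ℂ | ∃ t₁ t₂ : unitInterval, t₁ < t₂ ∧
                ((r < dist (c t₁) (c 0) ∧ dist (c t₂) (c 0) < η) ∨
                  (dist (c t₁) (c 1) < η ∧ r < dist (c t₂) (c 1)))}} ≤ ENNReal.ofReal ε)) →
      ∀ᵐ γ ∂(P D), Nonempty (Set.Icc (0 : ℝ) 1 ≃ₜ γ.range) → γ ∈ CurveClass.simple := by
  sorry

/-! ### Consistency: each named statement IS its registered stub (syntactically) -/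

theorem boundaryProximityBound_holds : BoundaryProximityBound := stub_boundaryProximityBound
theorem endpointReturnBound_holds : EndpointReturnBound := stub_endpointReturnBound
theorem tripleStrandBound_holds : TripleStrandBound := stub_tripleStrandBound
theorem boundaryAvoidancePassage_holds : BoundaryAvoidancePassage :=
  stub_boundaryAvoidance_of_bound
theorem noRetracePassage_holds : NoRetracePassage := stub_noRetrace_of_bounds

/-! ### Name-keyed aliases of the five statements — the hypotheses of `TameOfLimit_of`

The native skeleton audit (`#h21_check_skeleton`) admits a hypothesis of the skeleton theorem only if
its head constant is a registered obligation or is NAMED like a declared stub; `__Registered.stub_X`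
is the statement of `stub_X` under that name (device of `Cruxes/AxiomsOfLimit/Lines/birth.lean`; the
`__` namespace is an implementation detail, the gate-reserved `@[stub]` attribute is not written by a
planner). Each alias is definitionally its named statement. -/
namespace __Registered

/-- Alias of `BoundaryProximityBound` keyed by the registered stub name. -/
abbrev stub_boundaryProximityBound : Prop := BoundaryProximityBound
/-- Alias of `EndpointReturnBound` keyed by the registered stub name. -/
abbrev stub_endpointReturnBound : Prop := EndpointReturnBound
/-- Alias of `TripleStrandBound` keyed by the registered stub name. -/
abbrev stub_tripleStrandBound : Prop := TripleStrandBound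
/-- Alias of `BoundaryAvoidancePassage` keyed by the registered stub name. -/
abbrev stub_boundaryAvoidance_of_bound : Prop := BoundaryAvoidancePassage
/-- Alias of `NoRetracePassage` keyed by the registered stub name. -/
abbrev stub_noRetrace_of_bounds : Prop := NoRetracePassage

end __Registered

/-! ### The skeleton theorem: the five stubs imply the crux, BY NAME -/

/-- **`TameOfLimit` from the line `birth`** (kernel-checked, no `sorry` of its own): bundle the
crux's hypotheses into `SAW.IsScalingLimitFamily P`, choose an endpoint approximation of `D`
(`SAW.exists_isEndpointApprox`, proved in the tree), run the boundary passage S4 on the bound S1 and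
the no-retrace passage S5 on the bounds S3, S2, and join the two `P D`-a.e. clauses. Hypotheses = the
five stubs under their registered names; conclusion = the route decl, by name. -/
theorem TameOfLimit_of (h₁ : __Registered.stub_boundaryProximityBound)
    (h₂ : __Registered.stub_endpointReturnBound) (h₃ : __Registered.stub_tripleStrandBound)
    (h₄ : __Registered.stub_boundaryAvoidance_of_bound)
    (h₅ : __Registered.stub_noRetrace_of_bounds) :
    Summit.CriticalPhenomena.SAWScalingLimit.Theses.SAWTowerCount.TameOfLimit := by
  intro P hP hlim D
  have hsl : SAW.IsScalingLimitFamily P := ⟨hP, hlim⟩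
  obtain ⟨a, b, hab⟩ := SAW.exists_isEndpointApprox D
  have hba : ∀ᵐ γ ∂(P D), γ.range ∩ frontier D.carrier ⊆ {D.pt 0, D.pt 1} :=
    h₄ P hsl D ⟨a, b, hab, h₁ D a b hab⟩
  have hnr : ∀ᵐ γ ∂(P D),
      Nonempty (Set.Icc (0 : ℝ) 1 ≃ₜ γ.range) → γ ∈ CurveClass.simple :=
    h₅ P hsl D ⟨a, b, hab, h₃ D a b hab, h₂ D a b hab⟩
  exact hba.and hnr

/-- Wiring check (an `example`, so that `TameOfLimit_of` stays the only theorem concluding the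
crux): the registered stubs, with their tree-vocabulary types, feed the skeleton theorem as stated —
this term becomes the crux proof when the five `sorry`s above are discharged. -/
example : Summit.CriticalPhenomena.SAWScalingLimit.Theses.SAWTowerCount.TameOfLimit :=
  TameOfLimit_of stub_boundaryProximityBound stub_endpointReturnBound stub_tripleStrandBound
    stub_boundaryAvoidance_of_bound stub_noRetrace_of_bounds

end Summit.CriticalPhenomena.SAWScalingLimit.Cruxes.TameOfLimit.Birth

end
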